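import Summits.HubbardSuperconductivity.HubbardLadder.ObservableWindow
import Literature.MathematicalPhysics.QuantumManyBody.StateRelaxationKKT
import HarnessLib

/-!
# Rung R2/R3 — observable-window certificate rows WITH state-optimality (KKT) Gram blocks

HONEST FRAMING (page 1): ladder R1–R4 with certified numbers; no claim on H/H₀.

Block kind `kkt` of the cell's certificate format (pseudo seat, family F4): a rounded dual
certificate for an OBSERVABLE `V` in an energy window may contain, besides the Gram term
`Σ Λᵢⱼ Oᵢᴴ Oⱼ`, the null terms and the window multiplier `μ·(E_up·1 - A)` of `ObservableWindow`,
the state-optimality element `kktForm A G B = Σ_ab G_ab • (B_aᴴ (A B_b - B_b A))`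
(`Literature.….StateRelaxation.kktForm`) with a PSD multiplier `G` and generators `B_b` that
PRESERVE the sector (on the tori: words commuting with `N̂` and `S^z`). Its expectation is `≥ 0` in
every sector ground state (`re_vectorState_kktForm_nonneg_of_sectorGS`: the ground-state
inequality `⟨Cψ, (A - E_K) Cψ⟩ ≥ 0`, Bratteli–Robinson II Prop. 5.3.19, for `C = Σ_b L_kb B_b`,
`G = Lᴴ L`), so the rows of `ObservableWindowVector` / `ObservableWindow` survive with the extra
term treated as a nonnegative residual:

* §1 generic Hermitian `A`, sector `K`: `re_expect_ge_of_windowCertificate_kkt_of_sectorGS`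
  (+ `_residual`, + the upper reading `re_expect_le_of_windowCertificate_kkt_of_sectorGS`), and the
  SYMMETRY-REDUCED form `re_vectorState_ge_of_windowCertificate_symm_kkt` (symmetry-defect null
  terms `U Y Uᴴ - Y`, invariant objective; the orbit-averaged state of a sector ground state is an
  average of sector ground states, in each of which the KKT element is nonnegative);
* §2 the Hubbard tori (`TorusHamiltonianFamily`, sector `(N L, S^z = 0)`, the quantifier of
  `PairCorrWindowCert.sound`): `re_expect_sectorGS_ge_of_windowCertificate_kkt`,
  `re_expect_sectorGS_ge_of_windowCertificate_symm_kkt`, with the sector-preservation hypothesis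
  discharged by `Commute (B j) totalNumber ∧ Commute (B j) spinZ`
  (`kktGenerators_mapsTo_szSector`).

Validity (exactly what is proved): ANY Hermitian `A` — in particular the `t–t'` Hubbard tori at ANY
filling — provided the generators preserve the sector quantified over; the state must be a sector
GROUND state (`A ψ = E_K ψ`, `E_K = minEnergyOn A K`), not merely a low-energy eigenvector, which is
the quantifier of the R3 rows anyway. Charged generators (`c†`, `c`, pair creators) are NOT covered.
With the energy as objective the block is implied by optimality of the relaxation (Araújo et al.,
Prop. 11) and is value-neutral (pseudo seat, PSEUDO.md §6); with an observable objective it is a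
genuine constraint ("perturbative positivity", Scheer–Chadha–Lu–Khalaf 2025, eq. (2); Fawzi–Fawzi–Scalet
2024, §2). No certificate exists in this file; these are soundness edges (rows) for certificates produced
and checked elsewhere.
-/

namespace Summit.HubbardSuperconductivity.HubbardLadder

open Matrix Finset Filter Literature.Probability.LatticeModels
  Literature.MathematicalPhysics.QuantumLattice
  Literature.MathematicalPhysics.QuantumManyBody.StateRelaxation
open scoped ComplexOrder

-- `vectorState_apply` is written fully qualified below (clash-proof against the homonymous
-- `Literature.MathematicalPhysics.QuantumLattice.vectorState` of `CorrelationLightCone`, should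
-- that module ever enter the import closure); the `re_vectorState_…` names are unambiguous.

noncomputable section

/-! ## §1 Generic Hermitian matrix, sector ground states -/

section MatrixInstances

variable {n : Type*} [Fintype n] [DecidableEq n]
variable {m : Type*} [Fintype m] [DecidableEq m]
variable {p : Type*} [Fintype p] [DecidableEq p]

/-- **Window certificate with a KKT block ⇒ observable lower bound for EVERY sector ground state.**
For Hermitian `A`, a sector `K` with `minEnergyOn A K ≤ E_up`, annihilators valid on `K`, a
multiplier `G ⪰ 0` and generators `B_b` mapping `K` into `K`: an identity
`V - c·1 = Σᵢⱼ Λᵢⱼ Oᵢᴴ Oⱼ + (Σₖ (A Xₖ - Xₖ A) + Σₗ (Yₗ Zₗ + Z'ₗ Y'ₗ)) + μ·(E_up·1 - A) + kktForm A G B`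
(`Λ ⪰ 0`, `μ ≥ 0`) proves `c ≤ Re ⟨ψ, V ψ⟩` for every unit `ψ ∈ K` with `A ψ = E_K ψ`.
[cite: ScheerEtAl2025, §II eq. (2)] [cite: WangEtAl2024, §3 eq. (4)] -/
theorem re_expect_ge_of_windowCertificate_kkt_of_sectorGS {A : Matrix n n ℂ} (hA : A.IsHermitian)
    (K : Submodule ℂ (n → ℂ)) {Λ : Matrix m m ℂ} (hΛ : Λ.PosSemidef) (O : m → Matrix n n ℂ)
    {κ : Type*} (s : Finset κ) (X : κ → Matrix n n ℂ)
    {ι : Type*} (t : Finset ι) (Y Z Z' Y' : ι → Matrix n n ℂ)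
    (hZ : ∀ l ∈ t, ∀ w ∈ K, Z l *ᵥ w = 0) (hZ' : ∀ l ∈ t, ∀ w ∈ K, (Z' l)ᴴ *ᵥ w = 0)
    {G : Matrix p p ℂ} (hG : G.PosSemidef) (B : p → Matrix n n ℂ)
    (hB : ∀ j, ∀ w ∈ K, B j *ᵥ w ∈ K)
    {V : Matrix n n ℂ} {Eup μ c : ℝ} (hμ : 0 ≤ μ) (hE : A.minEnergyOn K ≤ Eup)
    (hcert : V - (c : ℂ) • (1 : Matrix n n ℂ) =
      gramForm Λ O + (∑ k ∈ s, (A * X k - X k * A) + ∑ l ∈ t, (Y l * Z l + Z' l * Y' l)) +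
        (μ : ℂ) • ((Eup : ℂ) • (1 : Matrix n n ℂ) - A) + kktForm A G B)
    {ψ : n → ℂ} (hψK : ψ ∈ K) (hψ1 : star ψ ⬝ᵥ ψ = 1)
    (hAψ : A *ᵥ ψ = ((A.minEnergyOn K : ℝ) : ℂ) • ψ) :
    c ≤ (star ψ ⬝ᵥ V *ᵥ ψ).re := by
  have hk := re_vectorState_kktForm_nonneg_of_sectorGS hA K hG B hB hψK hAψ
  have h := re_vectorState_ge_of_windowCertificate_residual hA hψ1 hAψ hΛ O s X t Y Z Z' Y'
    (fun l hl => hZ l hl ψ hψK) (fun l hl => hZ' l hl ψ hψK) (ε := 0)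
    (by rw [neg_zero]; exact hk) hμ hE hcert
  linarith

/-- **Rounded form**: as `re_expect_ge_of_windowCertificate_kkt_of_sectorGS` with a residual `r`,
`-ε ≤ Re ⟨ψ, r ψ⟩` (e.g. `Σ|coeff|` over contractions) ⇒ `c - ε ≤ Re ⟨ψ, V ψ⟩`.
[cite: KullEtAl2024, §5.3] [cite: ScheerEtAl2025, §II eq. (2)] -/
theorem re_expect_ge_of_windowCertificate_kkt_residual_of_sectorGS {A : Matrix n n ℂ}
    (hA : A.IsHermitian) (K : Submodule ℂ (n → ℂ)) {Λ : Matrix m m ℂ} (hΛ : Λ.PosSemidef)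
    (O : m → Matrix n n ℂ) {κ : Type*} (s : Finset κ) (X : κ → Matrix n n ℂ)
    {ι : Type*} (t : Finset ι) (Y Z Z' Y' : ι → Matrix n n ℂ)
    (hZ : ∀ l ∈ t, ∀ w ∈ K, Z l *ᵥ w = 0) (hZ' : ∀ l ∈ t, ∀ w ∈ K, (Z' l)ᴴ *ᵥ w = 0)
    {G : Matrix p p ℂ} (hG : G.PosSemidef) (B : p → Matrix n n ℂ)
    (hB : ∀ j, ∀ w ∈ K, B j *ᵥ w ∈ K)
    {V r : Matrix n n ℂ} {Eup μ c ε : ℝ} (hμ : 0 ≤ μ) (hE : A.minEnergyOn K ≤ Eup)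
    (hcert : V - (c : ℂ) • (1 : Matrix n n ℂ) =
      gramForm Λ O + (∑ k ∈ s, (A * X k - X k * A) + ∑ l ∈ t, (Y l * Z l + Z' l * Y' l)) +
        (μ : ℂ) • ((Eup : ℂ) • (1 : Matrix n n ℂ) - A) + kktForm A G B + r)
    {ψ : n → ℂ} (hψK : ψ ∈ K) (hψ1 : star ψ ⬝ᵥ ψ = 1)
    (hAψ : A *ᵥ ψ = ((A.minEnergyOn K : ℝ) : ℂ) • ψ) (hr : -ε ≤ (star ψ ⬝ᵥ r *ᵥ ψ).re) :
    c - ε ≤ (star ψ ⬝ᵥ V *ᵥ ψ).re := by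
  have hk := re_vectorState_kktForm_nonneg_of_sectorGS hA K hG B hB hψK hAψ
  have hkr : -ε ≤ (star ψ ⬝ᵥ (kktForm A G B + r) *ᵥ ψ).re := by
    rw [add_mulVec, dotProduct_add, Complex.add_re]
    linarith
  have hcert' : V - (c : ℂ) • (1 : Matrix n n ℂ) =
      gramForm Λ O + (∑ k ∈ s, (A * X k - X k * A) + ∑ l ∈ t, (Y l * Z l + Z' l * Y' l)) +
        (μ : ℂ) • ((Eup : ℂ) • (1 : Matrix n n ℂ) - A) + (kktForm A G B + r) := by
    rw [hcert, add_assoc]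
  exact re_vectorState_ge_of_windowCertificate_residual hA hψ1 hAψ hΛ O s X t Y Z Z' Y'
    (fun l hl => hZ l hl ψ hψK) (fun l hl => hZ' l hl ψ hψK) hkr hμ hE hcert'

/-- **Upper reading**: a window certificate with a KKT block for `-V` gives `Re ⟨ψ, V ψ⟩ ≤ -c`
for every sector ground state. [cite: ScheerEtAl2025, §II eq. (2)] [cite: WangEtAl2024, §3 eq. (4)] -/
theorem re_expect_le_of_windowCertificate_kkt_of_sectorGS {A : Matrix n n ℂ} (hA : A.IsHermitian)
    (K : Submodule ℂ (n → ℂ)) {Λ : Matrix m m ℂ} (hΛ : Λ.PosSemidef) (O : m → Matrix n n ℂ)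
    {κ : Type*} (s : Finset κ) (X : κ → Matrix n n ℂ)
    {ι : Type*} (t : Finset ι) (Y Z Z' Y' : ι → Matrix n n ℂ)
    (hZ : ∀ l ∈ t, ∀ w ∈ K, Z l *ᵥ w = 0) (hZ' : ∀ l ∈ t, ∀ w ∈ K, (Z' l)ᴴ *ᵥ w = 0)
    {G : Matrix p p ℂ} (hG : G.PosSemidef) (B : p → Matrix n n ℂ)
    (hB : ∀ j, ∀ w ∈ K, B j *ᵥ w ∈ K)
    {V : Matrix n n ℂ} {Eup μ c : ℝ} (hμ : 0 ≤ μ) (hE : A.minEnergyOn K ≤ Eup)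
    (hcert : -V - (c : ℂ) • (1 : Matrix n n ℂ) =
      gramForm Λ O + (∑ k ∈ s, (A * X k - X k * A) + ∑ l ∈ t, (Y l * Z l + Z' l * Y' l)) +
        (μ : ℂ) • ((Eup : ℂ) • (1 : Matrix n n ℂ) - A) + kktForm A G B)
    {ψ : n → ℂ} (hψK : ψ ∈ K) (hψ1 : star ψ ⬝ᵥ ψ = 1)
    (hAψ : A *ᵥ ψ = ((A.minEnergyOn K : ℝ) : ℂ) • ψ) :
    (star ψ ⬝ᵥ V *ᵥ ψ).re ≤ -c := by
  have h := re_expect_ge_of_windowCertificate_kkt_of_sectorGS hA K hΛ O s X t Y Z Z' Y' hZ hZ'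
    hG B hB hμ hE hcert hψK hψ1 hAψ
  rw [neg_mulVec, dotProduct_neg, Complex.neg_re] at h
  linarith

/-- **Symmetry-reduced window certificate with a KKT block ⇒ bound for EVERY sector ground state,
for an INVARIANT objective.** As `re_vectorState_ge_of_windowCertificate_symm` (finite unitary family
`T` commuting with `A`, adjoints preserving `K`, closed under right multiplication by the
certificate unitaries `U_l`; `T_g V T_gᴴ = V`), the certificate now also containing `kktForm A G B`
with `G ⪰ 0` and sector-preserving generators; the state must be a sector GROUND state
(`A v = E_K v`). Proof: the orbit-averaged state `|G|⁻¹ Σ_g ⟨T_gᴴ v, · T_gᴴ v⟩` is an average of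
vector states of sector ground states, in each of which the KKT element is nonnegative.
[cite: Han2020Bootstrap, §2 eq. (2)–(3)] [cite: ScheerEtAl2025, §II eq. (2)] -/
theorem re_vectorState_ge_of_windowCertificate_symm_kkt {A : Matrix n n ℂ} (hA : A.IsHermitian)
    (K : Submodule ℂ (n → ℂ)) {v : n → ℂ} (hvK : v ∈ K) (hv : star v ⬝ᵥ v = 1)
    (hAv : A *ᵥ v = ((A.minEnergyOn K : ℝ) : ℂ) • v)
    {G : Type*} [Fintype G] [Nonempty G] (T : G → Matrix n n ℂ)
    (hTA : ∀ g, T g * A = A * T g) (hTT : ∀ g, (T g)ᴴ * T g = 1)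
    (hTK : ∀ g, ∀ w ∈ K, (T g)ᴴ *ᵥ w ∈ K)
    {Λ : Matrix m m ℂ} (hΛ : Λ.PosSemidef) (O : m → Matrix n n ℂ)
    {κ : Type*} (s : Finset κ) (X : κ → Matrix n n ℂ)
    {ι : Type*} (t : Finset ι) (U Y : ι → Matrix n n ℂ)
    (hUT : ∀ l ∈ t, ∃ σ : G ≃ G, ∀ g, T g * U l = T (σ g))
    {ρ : Type*} (r : Finset ρ) (Y₁ Z Z' Y₂ : ρ → Matrix n n ℂ)
    (hZ : ∀ i ∈ r, ∀ w ∈ K, Z i *ᵥ w = 0) (hZ' : ∀ i ∈ r, ∀ w ∈ K, (Z' i)ᴴ *ᵥ w = 0)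
    {Gk : Matrix p p ℂ} (hGk : Gk.PosSemidef) (B : p → Matrix n n ℂ)
    (hB : ∀ j, ∀ w ∈ K, B j *ᵥ w ∈ K)
    {V : Matrix n n ℂ} (hV : ∀ g, T g * V * (T g)ᴴ = V) {Eup μ c : ℝ} (hμ : 0 ≤ μ)
    (hE : A.minEnergyOn K ≤ Eup)
    (hcert : V - (c : ℂ) • (1 : Matrix n n ℂ) =
      gramForm Λ O + (∑ k ∈ s, (A * X k - X k * A) + ∑ l ∈ t, (U l * Y l * (U l)ᴴ - Y l) +
          ∑ i ∈ r, (Y₁ i * Z i + Z' i * Y₂ i)) +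
        (μ : ℂ) • ((Eup : ℂ) • (1 : Matrix n n ℂ) - A) + kktForm A Gk B) :
    c ≤ (star v ⬝ᵥ V *ᵥ v).re := by
  -- the orbit vectors `w g = T_gᴴ v`: unit sector ground states in `K`
  have hTT' : ∀ g, T g * (T g)ᴴ = 1 := fun g => mul_eq_one_comm.mp (hTT g)
  have hTA' : ∀ g, (T g)ᴴ * A = A * (T g)ᴴ := fun g =>
    Matrix.conjTranspose_commute_of_commute hA (hTA g)
  have hw1 : ∀ g, star ((T g)ᴴ *ᵥ v) ⬝ᵥ ((T g)ᴴ *ᵥ v) = 1 := fun g => by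
    rw [star_mulVec, conjTranspose_conjTranspose, ← dotProduct_mulVec, mulVec_mulVec, hTT' g,
      one_mulVec, hv]
  have hAw : ∀ g, A *ᵥ ((T g)ᴴ *ᵥ v) = ((A.minEnergyOn K : ℝ) : ℂ) • ((T g)ᴴ *ᵥ v) := fun g =>
    conjTranspose_mulVec_eigenvector (hTA' g) hAv
  have hwK : ∀ g, (T g)ᴴ *ᵥ v ∈ K := fun g => hTK g v hvK
  have hcard : (Fintype.card G : ℂ) ≠ 0 := Nat.cast_ne_zero.mpr Fintype.card_ne_zero
  set ω := orbitVectorState T v with hω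
  have hinv : (0 : ℂ) ≤ (Fintype.card G : ℂ)⁻¹ := by
    rw [← Complex.ofReal_natCast, ← Complex.ofReal_inv]
    exact Complex.zero_le_real.mpr (inv_nonneg.mpr (Nat.cast_nonneg _))
  have hpos : ∀ a : Matrix n n ℂ, 0 ≤ ω (star a * a) := fun a => by
    rw [hω, orbitVectorState_apply]
    exact mul_nonneg hinv (Finset.sum_nonneg fun g _ => vectorState_nonneg _ a)
  have hconst : ∀ z : ℂ, (Fintype.card G : ℂ)⁻¹ * ∑ _g : G, z = z := fun z => by
    rw [Finset.sum_const, Finset.card_univ, nsmul_eq_mul, inv_mul_cancel_left₀ hcard]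
  have hone : ω 1 = 1 := by
    rw [hω, orbitVectorState_apply]
    simp_rw [Literature.MathematicalPhysics.QuantumManyBody.StateRelaxation.vectorState_apply,
      one_mulVec, hw1]
    exact hconst 1
  have hnull : ω (∑ k ∈ s, (A * X k - X k * A) + ∑ l ∈ t, (U l * Y l * (U l)ᴴ - Y l) +
      ∑ i ∈ r, (Y₁ i * Z i + Z' i * Y₂ i)) = 0 := by
    rw [map_add, map_add, map_sum, map_sum, map_sum]
    have h1 : ∀ k ∈ s, ω (A * X k - X k * A) = 0 := fun k _ => by
      rw [hω, orbitVectorState_apply]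
      simp_rw [vectorState_commutator hA (hAw _)]
      simp
    have h2 : ∀ l ∈ t, ω (U l * Y l * (U l)ᴴ - Y l) = 0 := fun l hl => by
      obtain ⟨σ, hσ⟩ := hUT l hl
      rw [map_sub, sub_eq_zero, hω, orbitVectorState_apply, orbitVectorState_apply]
      congr 1
      refine Fintype.sum_equiv σ _ _ (fun g => ?_)
      rw [← vectorState_conjTranspose_mulVec, mulVec_mulVec, ← conjTranspose_mul, hσ g]
    have h3 : ∀ i ∈ r, ω (Y₁ i * Z i + Z' i * Y₂ i) = 0 := fun i hi => by
      rw [hω, orbitVectorState_apply]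
      simp_rw [map_add, vectorState_mul_of_mulVec_eq_zero _ _ (hZ i hi _ (hwK _)),
        vectorState_mul_of_conjTranspose_mulVec_eq_zero _ _ (hZ' i hi _ (hwK _))]
      simp
    rw [Finset.sum_eq_zero h1, Finset.sum_eq_zero h2, Finset.sum_eq_zero h3, add_zero, add_zero]
  have hE' : (ω A).re ≤ Eup := by
    rw [hω, orbitVectorState_apply]
    simp_rw [Literature.MathematicalPhysics.QuantumManyBody.StateRelaxation.vectorState_apply,
      hAw, dotProduct_smul, hw1, smul_eq_mul, mul_one]
    rw [hconst, Complex.ofReal_re]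
    exact hE
  have hωV : ω V = star v ⬝ᵥ V *ᵥ v := by
    rw [hω, orbitVectorState_apply]
    simp_rw [vectorState_conjTranspose_mulVec, hV,
      Literature.MathematicalPhysics.QuantumManyBody.StateRelaxation.vectorState_apply]
    exact hconst _
  -- the KKT element is nonnegative in the orbit-averaged state
  have hkkt : 0 ≤ (ω (kktForm A Gk B)).re := by
    have him : ((Fintype.card G : ℂ)⁻¹).im = 0 := by
      rw [← Complex.ofReal_natCast, ← Complex.ofReal_inv, Complex.ofReal_im]
    have hre : 0 ≤ ((Fintype.card G : ℂ)⁻¹).re := by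
      rw [← Complex.ofReal_natCast, ← Complex.ofReal_inv, Complex.ofReal_re]
      exact inv_nonneg.mpr (Nat.cast_nonneg _)
    rw [hω, orbitVectorState_apply, Complex.mul_re, him, zero_mul, sub_zero, Complex.re_sum]
    refine mul_nonneg hre (Finset.sum_nonneg fun g _ => ?_)
    rw [Literature.MathematicalPhysics.QuantumManyBody.StateRelaxation.vectorState_apply]
    exact re_vectorState_kktForm_nonneg_of_sectorGS hA K hGk B hB (hwK g) (hAw g)
  have h := le_re_map_of_windowCertificate_residual ω hpos hone hΛ O hnull (ε := 0)
    (r := kktForm A Gk B) (by rw [neg_zero]; exact hkkt) hμ hE' hcert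
  rw [hωV, sub_zero] at h
  exact h

end MatrixInstances

/-! ## §2 The Hubbard tori: `(N, S^z = 0)` sector ground states -/

section HubbardRows

variable {m : Type*} [Fintype m] [DecidableEq m]
variable {p : Type*} [Fintype p] [DecidableEq p]

omit [Fintype p] [DecidableEq p] in
/-- Generators commuting with `N̂` and `S^z` preserve the `(N, S^z = M)` sector — the discharge of
the sector-preservation hypothesis of the KKT rows for `N`-, `S^z`-conserving words
(`Literature.….mulVec_mem_szSector_of_commute`). [cite: FawziFawziScalet2024, §2] -/
theorem kktGenerators_mapsTo_szSector {Λ : Type*} [LinearOrder Λ] [Fintype Λ] {N : ℕ} {M : ℝ}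
    (B : p → Matrix (Finset (Orb Λ)) (Finset (Orb Λ)) ℂ)
    (hBN : ∀ j, Commute (B j) totalNumber) (hBS : ∀ j, Commute (B j) HubbardWave0.spinZ) :
    ∀ j, ∀ w ∈ szSector (Λ := Λ) N M, B j *ᵥ w ∈ szSector (Λ := Λ) N M :=
  fun j _ hw => mulVec_mem_szSector_of_commute (hBN j) (hBS j) hw

/-- **R2 ⇒ R3 soundness edge with a KKT block.** On the `L × L` torus with Hamiltonian family `H`,
filling `N` and energy window `minEnergyOn (H L) (szSector (N L) 0) ≤ E_up`: a window certificate
for `V` with annihilator terms vanishing on the sector, a multiplier `G ⪰ 0` and generators `B_j`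
preserving the `(N L, S^z = 0)` sector (e.g. `kktGenerators_mapsTo_szSector`) bounds
`Re ⟨ψ, V ψ⟩ ≥ c` for EVERY normalised sector ground state `ψ` — the quantifier of
`PairCorrWindowCert.sound`; valid at any filling and any `t'`.
[cite: ScheerEtAl2025, §II eq. (2)] [cite: WangEtAl2024, §3 eq. (4)] -/
theorem re_expect_sectorGS_ge_of_windowCertificate_kkt {H : TorusHamiltonianFamily} {N : ℕ → ℕ}
    {L : ℕ} (hH : (H L).IsHermitian) {Gm : Matrix m m ℂ} (hGm : Gm.PosSemidef)
    (O : m → Matrix (Finset (Orb (FermionTorus 2 L))) (Finset (Orb (FermionTorus 2 L))) ℂ)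
    {κ : Type*} (s : Finset κ)
    (X : κ → Matrix (Finset (Orb (FermionTorus 2 L))) (Finset (Orb (FermionTorus 2 L))) ℂ)
    {ι : Type*} (t : Finset ι)
    (Y Z Z' Y' : ι → Matrix (Finset (Orb (FermionTorus 2 L))) (Finset (Orb (FermionTorus 2 L))) ℂ)
    (hZ : ∀ l ∈ t, ∀ w ∈ szSector (Λ := FermionTorus 2 L) (N L) 0, Z l *ᵥ w = 0)
    (hZ' : ∀ l ∈ t, ∀ w ∈ szSector (Λ := FermionTorus 2 L) (N L) 0, (Z' l)ᴴ *ᵥ w = 0)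
    {G : Matrix p p ℂ} (hG : G.PosSemidef)
    (B : p → Matrix (Finset (Orb (FermionTorus 2 L))) (Finset (Orb (FermionTorus 2 L))) ℂ)
    (hB : ∀ j, ∀ w ∈ szSector (Λ := FermionTorus 2 L) (N L) 0,
      B j *ᵥ w ∈ szSector (Λ := FermionTorus 2 L) (N L) 0)
    {V : Matrix (Finset (Orb (FermionTorus 2 L))) (Finset (Orb (FermionTorus 2 L))) ℂ}
    {Eup μ c : ℝ} (hμ : 0 ≤ μ)
    (hE : (H L).minEnergyOn (szSector (Λ := FermionTorus 2 L) (N L) 0) ≤ Eup)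
    (hcert : V - (c : ℂ) • 1 =
      gramForm Gm O + (∑ k ∈ s, (H L * X k - X k * H L) + ∑ l ∈ t, (Y l * Z l + Z' l * Y' l)) +
        (μ : ℂ) • ((Eup : ℂ) • 1 - H L) + kktForm (H L) G B) :
    ∀ ψ : Fock (Orb (FermionTorus 2 L)), star ψ ⬝ᵥ ψ = 1 →
      IsGroundStateInSector (H L) (N L) 0 ψ → c ≤ (star ψ ⬝ᵥ V *ᵥ ψ).re :=
  fun _ψ h1 hgs =>
    re_expect_ge_of_windowCertificate_kkt_of_sectorGS hH (szSector (N L) 0) hGm O s X t Y Z Z' Y'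
      hZ hZ' hG B hB hμ hE hcert hgs.1 h1 hgs.2.2

/-- **R2 ⇒ R3 soundness edge, symmetry-reduced certificate with a KKT block.** As
`re_expect_sectorGS_ge_of_windowCertificate_symm` (finite unitary family `T` commuting with `H L`,
adjoints preserving the sector, closed under right multiplication by the certificate unitaries;
INVARIANT objective `T_g V T_gᴴ = V`), the certificate also containing `kktForm (H L) G B` with
`G ⪰ 0` and sector-preserving generators: the bound holds for EVERY normalised sector ground state.
[cite: Han2020Bootstrap, §2 eq. (2)–(3)] [cite: ScheerEtAl2025, §II eq. (2)] -/
theorem re_expect_sectorGS_ge_of_windowCertificate_symm_kkt {H : TorusHamiltonianFamily}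
    {N : ℕ → ℕ} {L : ℕ} (hH : (H L).IsHermitian)
    {G : Type*} [Fintype G] [Nonempty G]
    (T : G → Matrix (Finset (Orb (FermionTorus 2 L))) (Finset (Orb (FermionTorus 2 L))) ℂ)
    (hTA : ∀ g, T g * H L = H L * T g) (hTT : ∀ g, (T g)ᴴ * T g = 1)
    (hTK : ∀ g, ∀ w ∈ szSector (Λ := FermionTorus 2 L) (N L) 0,
      (T g)ᴴ *ᵥ w ∈ szSector (Λ := FermionTorus 2 L) (N L) 0)
    {Gm : Matrix m m ℂ} (hGm : Gm.PosSemidef)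
    (O : m → Matrix (Finset (Orb (FermionTorus 2 L))) (Finset (Orb (FermionTorus 2 L))) ℂ)
    {κ : Type*} (s : Finset κ)
    (X : κ → Matrix (Finset (Orb (FermionTorus 2 L))) (Finset (Orb (FermionTorus 2 L))) ℂ)
    {ι : Type*} (t : Finset ι)
    (U Y : ι → Matrix (Finset (Orb (FermionTorus 2 L))) (Finset (Orb (FermionTorus 2 L))) ℂ)
    (hUT : ∀ l ∈ t, ∃ σ : G ≃ G, ∀ g, T g * U l = T (σ g))
    {ρ : Type*} (r : Finset ρ)
    (Y₁ Z Z' Y₂ : ρ → Matrix (Finset (Orb (FermionTorus 2 L))) (Finset (Orb (FermionTorus 2 L))) ℂ)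
    (hZ : ∀ i ∈ r, ∀ w ∈ szSector (Λ := FermionTorus 2 L) (N L) 0, Z i *ᵥ w = 0)
    (hZ' : ∀ i ∈ r, ∀ w ∈ szSector (Λ := FermionTorus 2 L) (N L) 0, (Z' i)ᴴ *ᵥ w = 0)
    {Gk : Matrix p p ℂ} (hGk : Gk.PosSemidef)
    (B : p → Matrix (Finset (Orb (FermionTorus 2 L))) (Finset (Orb (FermionTorus 2 L))) ℂ)
    (hB : ∀ j, ∀ w ∈ szSector (Λ := FermionTorus 2 L) (N L) 0,
      B j *ᵥ w ∈ szSector (Λ := FermionTorus 2 L) (N L) 0)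
    {V : Matrix (Finset (Orb (FermionTorus 2 L))) (Finset (Orb (FermionTorus 2 L))) ℂ}
    (hV : ∀ g, T g * V * (T g)ᴴ = V)
    {Eup μ c : ℝ} (hμ : 0 ≤ μ)
    (hE : (H L).minEnergyOn (szSector (Λ := FermionTorus 2 L) (N L) 0) ≤ Eup)
    (hcert : V - (c : ℂ) • 1 =
      gramForm Gm O + (∑ k ∈ s, (H L * X k - X k * H L) + ∑ l ∈ t, (U l * Y l * (U l)ᴴ - Y l) +
          ∑ i ∈ r, (Y₁ i * Z i + Z' i * Y₂ i)) +
        (μ : ℂ) • ((Eup : ℂ) • 1 - H L) + kktForm (H L) Gk B) :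
    ∀ ψ : Fock (Orb (FermionTorus 2 L)), star ψ ⬝ᵥ ψ = 1 →
      IsGroundStateInSector (H L) (N L) 0 ψ → c ≤ (star ψ ⬝ᵥ V *ᵥ ψ).re :=
  fun _ψ h1 hgs =>
    re_vectorState_ge_of_windowCertificate_symm_kkt hH (szSector (N L) 0) hgs.1 h1 hgs.2.2 T hTA hTT
      hTK hGm O s X t U Y hUT r Y₁ Z Z' Y₂ hZ hZ' hGk B hB hV hμ hE hcert

end HubbardRows

end

end Summit.HubbardSuperconductivity.HubbardLadder
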